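import Literature.MeasureTheory.Group.SL2IwasawaHaar
import Literature.NumberTheory.Automorphic.HyperbolicLaplaceSpectrum
import Mathlib.MeasureTheory.Group.FundamentalDomain
import HarnessLib

/-!
# Gauss's fundamental domain for the left action of `GL₂(ℤ)` on `SL₂^±(ℝ)`

Topic `Literature/MeasureTheory/Group`; continues `SL2IwasawaHaar.lean` (the Haar measure
`haarSL2pm` of `SL₂^±(ℝ) = {det = ±1}` in Iwasawa coordinates and its left invariance).
Everything here is PROVED (no named facts).

Bhargava–Shankar (Ann. of Math. 181 (2015), §2.1 and §2.3 of `arXiv:1006.1002v2`) count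
`GL₂(ℤ)`-orbits by integrating over "Gauss's usual fundamental domain `F` for
`GL₂(ℤ) \ GL₂(ℝ)`", `F = N'A'KΛ`, and unfold orbit sums over it ("as `dh` is an invariant
measure on `G`"). This file provides that domain, modulo scalars, as a Mathlib
`MeasureTheory.IsFundamentalDomain` — the structure consumed by Mathlib's unfolding lemmas
(`IsFundamentalDomain.measure_eq_tsum`, `lintegral_eq_tsum`, …):

* `gl2zGL ≤ GL (Fin 2) ℝ` — the image of `GL₂(ℤ)`, a countable subgroup acting on `M₂(ℝ)` by
  left multiplication (Mathlib's action of units), measurably and **preserving `haarSL2pm`**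
  (`smulInvariantMeasure_gl2zGL`, from `map_mul_left_haarSL2pm` since `det = ±1`);
* `gaussFD = {g ∈ SL₂(ℝ) : g • i ∈ 𝒟, θ(g) ∈ [0, π)}` with `𝒟` Mathlib's standard fundamental
  domain of `SL₂(ℤ)` in `ℍ` (`ModularGroup.fd`; the angle condition accounts for `−1 ∈ GL₂(ℤ)`,
  the restriction to `det = 1` for the elements of determinant `−1`);
* `isFundamentalDomain_gaussFD` — **`gaussFD` is a fundamental domain** for `gl2zGL` acting on
  `(M₂(ℝ), haarSL2pm)`: every element of `{det = ±1}` has a translate in it (Mathlib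
  `ModularGroup.exists_smul_mem_fd` and `θ(−g) = θ(g) + π`), and distinct translates meet only
  inside the null set of `g` with `g • i ∈ 𝒟 ∖ 𝒟ᵒ` (Mathlib
  `ModularGroup.eq_one_or_neg_one_of_mem_fdo_mem_fd`; the boundary of `𝒟` is null,
  `Literature.NumberTheory.Automorphic.volume_modular_fd_diff_fdo`);
* `haarSL2pm_gaussFD` — **its volume is `vol(𝒟) · π = (π/3) · π = π²/3`**
  (`Literature.NumberTheory.Automorphic.volume_modular_fd`), i.e. `2 ζ(2)`: twice
  Bhargava–Shankar's normalisation `∫_{F_{SL₂}} dg = ζ(2)` of their eq. (18), their `dg` being half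
  of `y⁻² dx dy dθ`.

## References

* M. Bhargava, A. Shankar, Ann. of Math. (2) 181 (2015) 191–242, §2.1 ("Gauss's usual fundamental
  domain for `GL₂(ℤ)\GL₂(ℝ)`"), §2.3–2.4 (eq. (18): `∫_{F} dg = ζ(2)`); arXiv:1006.1002v2
  numbering. [cite: BhargavaShankarAnnals2015, §2.1 and eq. (18) (arXiv:1006.1002v2 numbering)]
-/

noncomputable section

open MeasureTheory Complex
open scoped MatrixGroups Real UpperHalfPlane Modular Pointwise

namespace Literature.MeasureTheory.Group

attribute [local instance] fact_two_pi_pos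

/-! ## `GL₂(ℤ)` as a subgroup of `GL₂(ℝ)` acting on `M₂(ℝ)` -/

/-- `GL₂(ℤ)` inside `GL₂(ℝ)`: the range of the map induced by `ℤ → ℝ`. [folklore] -/
def gl2zGL : Subgroup (GL (Fin 2) ℝ) :=
  (Matrix.GeneralLinearGroup.map (n := Fin 2) (Int.castRingHom ℝ)).range

/-- `GL₂(ℤ)` is countable. [folklore] -/
instance countable_gl2zGL : Countable gl2zGL := by
  have : Countable (Matrix (Fin 2) (Fin 2) ℤ) := inferInstanceAs (Countable (Fin 2 → Fin 2 → ℤ))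
  have : Countable (GL (Fin 2) ℤ) :=
    Function.Injective.countable (f := fun u : GL (Fin 2) ℤ => (u : Matrix (Fin 2) (Fin 2) ℤ))
      Units.val_injective
  unfold gl2zGL
  exact Set.countable_coe_iff.mpr (Set.countable_range _)

/-- An element of `GL₂(ℤ)` comes from an integral unit matrix. [folklore] -/
theorem exists_eq_map_of_mem (γ : gl2zGL) :
    ∃ u : GL (Fin 2) ℤ, (γ : GL (Fin 2) ℝ) = Matrix.GeneralLinearGroup.map (Int.castRingHom ℝ) u :=
  let ⟨u, hu⟩ := γ.2; ⟨u, hu.symm⟩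

/-- The underlying real matrix of the image of `u ∈ GL₂(ℤ)` is the entrywise cast. [folklore] -/
theorem coe_map_eq (u : GL (Fin 2) ℤ) :
    ((Matrix.GeneralLinearGroup.map (Int.castRingHom ℝ) u : GL (Fin 2) ℝ) : Matrix (Fin 2) (Fin 2) ℝ) =
      (u : Matrix (Fin 2) (Fin 2) ℤ).map (Int.castRingHom ℝ) := rfl

/-- Elements of `GL₂(ℤ)` have determinant `±1` (as real matrices). [folklore] -/
theorem det_coe_gl2zGL (γ : gl2zGL) :
    ((γ : GL (Fin 2) ℝ) : Matrix (Fin 2) (Fin 2) ℝ).det = 1 ∨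
      ((γ : GL (Fin 2) ℝ) : Matrix (Fin 2) (Fin 2) ℝ).det = -1 := by
  obtain ⟨u, hu⟩ := exists_eq_map_of_mem γ
  rw [hu, coe_map_eq, ← RingHom.mapMatrix_apply, ← RingHom.map_det]
  have hunit : IsUnit (u : Matrix (Fin 2) (Fin 2) ℤ).det := by
    rw [← Matrix.GeneralLinearGroup.val_det_apply]; exact Units.isUnit _
  rcases Int.isUnit_iff.mp hunit with h | h <;> simp [h]

/-- The action of `γ ∈ GL₂(ℤ)` on `M₂(ℝ)` is left multiplication. [folklore] -/
theorem gl2zGL_smul_def (γ : gl2zGL) (M : Matrix (Fin 2) (Fin 2) ℝ) :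
    γ • M = ((γ : GL (Fin 2) ℝ) : Matrix (Fin 2) (Fin 2) ℝ) * M := rfl

section Measure

variable [MeasurableSpace (Matrix (Fin 2) (Fin 2) ℝ)] [BorelSpace (Matrix (Fin 2) (Fin 2) ℝ)]

/-- `GL₂(ℤ)` acts measurably on `M₂(ℝ)`. [folklore] -/
instance measurableConstSMul_gl2zGL : MeasurableConstSMul gl2zGL (Matrix (Fin 2) (Fin 2) ℝ) :=
  ⟨fun _ => measurable_mul_left _⟩

/-- **`GL₂(ℤ)` preserves the Haar measure of `SL₂^±(ℝ)`.** [folklore] -/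
instance smulInvariantMeasure_gl2zGL :
    SMulInvariantMeasure gl2zGL (Matrix (Fin 2) (Fin 2) ℝ) haarSL2pm :=
  ⟨fun γ _ hs => haarSL2pm_preimage_mul_left (det_coe_gl2zGL γ) hs⟩

end Measure

/-! ## The Gauss fundamental domain in coordinates -/

/-- The standard fundamental domain of `SL₂(ℤ)` as a subset of `ℂ`:
`{w : 1 ≤ |w|², |Re w| ≤ 1/2}`. [folklore] -/
def fdC : Set ℂ := {w | 1 ≤ Complex.normSq w ∧ |w.re| ≤ 1 / 2}

/-- Its interior part `{w : 1 < |w|², |Re w| < 1/2}`. [folklore] -/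
def fdoC : Set ℂ := {w | 1 < Complex.normSq w ∧ |w.re| < 1 / 2}

/-- `fdC` pulls back to Mathlib's `ModularGroup.fd`. [folklore] -/
theorem coe_preimage_fdC : ((↑) : ℍ → ℂ) ⁻¹' fdC = 𝒟 := by
  ext z; rfl

/-- `fdoC` pulls back to Mathlib's `ModularGroup.fdo`. [folklore] -/
theorem coe_preimage_fdoC : ((↑) : ℍ → ℂ) ⁻¹' fdoC = 𝒟ᵒ := by
  ext z; rfl

/-- `fdC` is measurable. [folklore] -/
theorem measurableSet_fdC : MeasurableSet fdC := by
  unfold fdC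
  exact (measurableSet_le measurable_const Complex.continuous_normSq.measurable).inter
    (measurableSet_le (Complex.continuous_re.measurable.abs) measurable_const)

/-- `fdoC` is measurable. [folklore] -/
theorem measurableSet_fdoC : MeasurableSet fdoC := by
  unfold fdoC
  exact (measurableSet_lt measurable_const Complex.continuous_normSq.measurable).inter
    (measurableSet_lt (Complex.continuous_re.measurable.abs) measurable_const)

/-- **Gauss's fundamental domain** for `GL₂(ℤ)` acting on `SL₂^±(ℝ)` by left multiplication:
`F = {g ∈ SL₂(ℝ) : g • i ∈ 𝒟, θ(g) ∈ [0, π)}` (the angle condition accounts for `−1 ∈ GL₂(ℤ)`;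
Bhargava–Shankar's `F = N'A'KΛ ∩ SL₂`). [folklore] -/
def gaussFD : Set (Matrix (Fin 2) (Fin 2) ℝ) := coordSet fdC (arc 0 π)

/-- Membership of `g ∈ SL₂(ℝ)` in `F`: `g • i ∈ 𝒟` and `θ(g) ∈ [0, π)`. [folklore] -/
theorem mem_gaussFD_iff_of_det_one (g : SL(2, ℝ)) :
    (g : Matrix (Fin 2) (Fin 2) ℝ) ∈ gaussFD ↔
      g • UpperHalfPlane.I ∈ 𝒟 ∧ angleOf (g : Matrix (Fin 2) (Fin 2) ℝ) ∈ arc 0 π := by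
  rw [gaussFD, mem_coordSet_iff]
  have h1 : (g : Matrix (Fin 2) (Fin 2) ℝ).det = 1 := g.det_coe
  simp only [h1, true_and]
  rw [← coe_preimage_fdC, Set.mem_preimage, coe_smul_I_eq]

/-! ## Angles: `θ(−g) = θ(g) + π` -/

/-- `θ(−g) = θ(g) + π` (Mathlib `Complex.arg_neg_coe_angle`). [folklore] -/
theorem angleOf_neg {g : Matrix (Fin 2) (Fin 2) ℝ} (hg : g 1 0 ≠ 0 ∨ g 1 1 ≠ 0) :
    angleOf (-g) = angleOf g + ((π : ℝ) : AddCircle (2 * π)) := by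
  have hw : (⟨g 1 1, -g 1 0⟩ : ℂ) ≠ 0 := by
    intro h0
    have h1 := congrArg Complex.re h0
    have h2 := congrArg Complex.im h0
    simp at h1 h2
    rcases hg with h | h
    · exact h h2
    · exact h h1
  have e : (⟨(-g) 1 1, -(-g) 1 0⟩ : ℂ) = -⟨g 1 1, -g 1 0⟩ := by
    apply Complex.ext <;> simp
  unfold angleOf
  rw [e]
  exact Complex.arg_neg_coe_angle hw

/-- Every angle lies in `[0, π)` or does so after adding `π`. [folklore] -/
theorem mem_arc_zero_pi_or (θ : AddCircle (2 * π)) :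
    θ ∈ arc 0 π ∨ θ + ((π : ℝ) : AddCircle (2 * π)) ∈ arc 0 π := by
  obtain ⟨t, ht, rfl⟩ : ∃ t ∈ Set.Ico (-π) (-π + 2 * π), (t : AddCircle (2 * π)) = θ :=
    ⟨(AddCircle.equivIco (2 * π) (-π) θ : ℝ), (AddCircle.equivIco (2 * π) (-π) θ).2,
      (AddCircle.equivIco (2 * π) (-π)).symm_apply_apply θ⟩
  rcases le_or_gt 0 t with h | h
  · left; exact ⟨t, ⟨h, by linarith [ht.2]⟩, rfl⟩
  · right
    refine ⟨t + π, ⟨by linarith [ht.1], by linarith⟩, ?_⟩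
    rw [AddCircle.coe_add]

/-- An angle and its translate by `π` are not both in `[0, π)`. [folklore] -/
theorem not_mem_arc_zero_pi_and (θ : AddCircle (2 * π)) :
    ¬ (θ ∈ arc 0 π ∧ θ + ((π : ℝ) : AddCircle (2 * π)) ∈ arc 0 π) := by
  rintro ⟨⟨t, ht, rfl⟩, ⟨t', ht', h⟩⟩
  have hπ := Real.pi_pos
  rw [← AddCircle.coe_add, AddCircle.coe_eq_coe_iff_of_mem_Ico (p := 2 * π) (a := 0)
    ⟨ht'.1, by linarith [ht'.2]⟩ ⟨by linarith [ht.1], by linarith [ht.2]⟩] at h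
  linarith [ht.1, ht'.2]

/-! ## The translates of `F` cover `SL₂^±(ℝ)` -/

/-- The image of `δ ∈ SL₂(ℤ)` in `GL₂(ℤ) ≤ GL₂(ℝ)`. [folklore] -/
def ofSL2Z (δ : SL(2, ℤ)) : gl2zGL :=
  ⟨Matrix.GeneralLinearGroup.map (Int.castRingHom ℝ) (Matrix.SpecialLinearGroup.toGL δ),
    ⟨Matrix.SpecialLinearGroup.toGL δ, rfl⟩⟩

/-- The real matrix of `ofSL2Z δ` is the cast of `δ`. [folklore] -/
theorem coe_ofSL2Z (δ : SL(2, ℤ)) :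
    (((ofSL2Z δ : gl2zGL) : GL (Fin 2) ℝ) : Matrix (Fin 2) (Fin 2) ℝ) =
      ((δ : SL(2, ℝ)) : Matrix (Fin 2) (Fin 2) ℝ) := by
  rfl

/-- The element `diag(1, −1) ∈ GL₂(ℤ)`. [folklore] -/
def sigmaZ : GL (Fin 2) ℤ :=
  ⟨!![1, 0; 0, -1], !![1, 0; 0, -1], by ext i j; fin_cases i <;> fin_cases j <;> simp,
    by ext i j; fin_cases i <;> fin_cases j <;> simp⟩

/-- Its image in `GL₂(ℤ) ≤ GL₂(ℝ)` has underlying matrix `σ`. [folklore] -/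
def sigmaGL : gl2zGL :=
  ⟨Matrix.GeneralLinearGroup.map (Int.castRingHom ℝ) sigmaZ, ⟨sigmaZ, rfl⟩⟩

/-- The real matrix of `sigmaGL` is `σ = diag(1, −1)`. [folklore] -/
theorem coe_sigmaGL : (((sigmaGL : gl2zGL) : GL (Fin 2) ℝ) : Matrix (Fin 2) (Fin 2) ℝ) = sigmaMat := by
  change (sigmaZ : Matrix (Fin 2) (Fin 2) ℤ).map (Int.castRingHom ℝ) = sigmaMat
  ext i j; fin_cases i <;> fin_cases j <;> simp [sigmaZ, sigmaMat]

/-- Every `g ∈ SL₂(ℝ)` has a `GL₂(ℤ)`-translate in `F`. [folklore] -/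
theorem exists_smul_mem_gaussFD_of_det_one (g : SL(2, ℝ)) :
    ∃ γ : gl2zGL, γ • (g : Matrix (Fin 2) (Fin 2) ℝ) ∈ gaussFD := by
  obtain ⟨δ, hδ⟩ := ModularGroup.exists_smul_mem_fd (g • UpperHalfPlane.I)
  -- the two candidates `±δ g`
  have key : ∀ ε : SL(2, ℤ), (ε : SL(2, ℝ)) • (g • UpperHalfPlane.I) = ε • (g • UpperHalfPlane.I) := by
    intro ε; rfl
  have hmem : ∀ ε : SL(2, ℤ), ε • (g • UpperHalfPlane.I) ∈ 𝒟 →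
      angleOf (((ε : SL(2, ℝ)) * g : SL(2, ℝ)) : Matrix (Fin 2) (Fin 2) ℝ) ∈ arc 0 π →
      (ofSL2Z ε) • (g : Matrix (Fin 2) (Fin 2) ℝ) ∈ gaussFD := by
    intro ε hε hθ
    rw [gl2zGL_smul_def, coe_ofSL2Z, ← Matrix.SpecialLinearGroup.coe_mul,
      mem_gaussFD_iff_of_det_one, mul_smul, key]
    exact ⟨hε, hθ⟩
  rcases mem_arc_zero_pi_or (angleOf (((δ : SL(2, ℝ)) * g : SL(2, ℝ)) : Matrix (Fin 2) (Fin 2) ℝ))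
    with h | h
  · exact ⟨ofSL2Z δ, hmem δ hδ h⟩
  · refine ⟨ofSL2Z (-δ), hmem (-δ) ?_ ?_⟩
    · rw [ModularGroup.SL_neg_smul]; exact hδ
    · have e1 : (((-δ : SL(2, ℤ)) : SL(2, ℝ)) : Matrix (Fin 2) (Fin 2) ℝ) =
          -((δ : SL(2, ℝ)) : Matrix (Fin 2) (Fin 2) ℝ) := by
        ext i j
        simp
      have e : ((((-δ : SL(2, ℤ)) : SL(2, ℝ)) * g : SL(2, ℝ)) : Matrix (Fin 2) (Fin 2) ℝ) =
          -((((δ : SL(2, ℝ)) * g : SL(2, ℝ)) : Matrix (Fin 2) (Fin 2) ℝ)) := by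
        rw [Matrix.SpecialLinearGroup.coe_mul, Matrix.SpecialLinearGroup.coe_mul, e1, Matrix.neg_mul]
      rw [e, angleOf_neg]
      · exact h
      · -- the bottom row of an element of `SL₂(ℝ)` is nonzero
        set M : SL(2, ℝ) := (δ : SL(2, ℝ)) * g
        by_contra hc
        push Not at hc
        have hdet : (M : Matrix (Fin 2) (Fin 2) ℝ).det = 1 := M.det_coe
        rw [Matrix.det_fin_two, hc.1, hc.2] at hdet
        simp at hdet

/-- Every `g ∈ SL₂^±(ℝ)` has a `GL₂(ℤ)`-translate in `F`. [folklore] -/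
theorem exists_smul_mem_gaussFD {g : Matrix (Fin 2) (Fin 2) ℝ} (hg : g.det = 1 ∨ g.det = -1) :
    ∃ γ : gl2zGL, γ • g ∈ gaussFD := by
  rcases hg with hg | hg
  · exact exists_smul_mem_gaussFD_of_det_one ⟨g, hg⟩
  · have hg' : (sigmaMat * g).det = 1 := by rw [Matrix.det_mul, det_sigmaMat, hg]; norm_num
    obtain ⟨γ, hγ⟩ := exists_smul_mem_gaussFD_of_det_one ⟨sigmaMat * g, hg'⟩
    refine ⟨γ * sigmaGL, ?_⟩
    rw [mul_smul, gl2zGL_smul_def sigmaGL, coe_sigmaGL]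
    exact hγ

/-! ## The translates of `F` are almost disjoint -/

/-- An element of `GL₂(ℤ)` whose real matrix has determinant `1` comes from `SL₂(ℤ)`. [folklore] -/
theorem exists_ofSL2Z_eq (γ : gl2zGL) (hγ : ((γ : GL (Fin 2) ℝ) : Matrix (Fin 2) (Fin 2) ℝ).det = 1) :
    ∃ δ : SL(2, ℤ), ofSL2Z δ = γ := by
  obtain ⟨u, hu⟩ := exists_eq_map_of_mem γ
  have hdet : (u : Matrix (Fin 2) (Fin 2) ℤ).det = 1 := by
    rw [hu, coe_map_eq, ← RingHom.mapMatrix_apply, ← RingHom.map_det, eq_intCast] at hγ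
    exact_mod_cast hγ
  refine ⟨⟨(u : Matrix (Fin 2) (Fin 2) ℤ), hdet⟩, ?_⟩
  apply Subtype.ext
  rw [hu]
  ext i j
  rfl

/-- The bad set: elements of `SL₂(ℝ)` mapping `i` to the boundary of `𝒟`. [folklore] -/
def badSet : Set (Matrix (Fin 2) (Fin 2) ℝ) := coordSet (fdC \ fdoC) Set.univ

/-- Membership of `g ∈ SL₂(ℝ)` in the bad set: `g • i ∈ 𝒟 ∖ 𝒟ᵒ`. [folklore] -/
theorem mem_badSet_iff_of_det_one (g : SL(2, ℝ)) :
    (g : Matrix (Fin 2) (Fin 2) ℝ) ∈ badSet ↔ g • UpperHalfPlane.I ∈ 𝒟 \ 𝒟ᵒ := by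
  rw [badSet, mem_coordSet_iff]
  have h1 : (g : Matrix (Fin 2) (Fin 2) ℝ).det = 1 := g.det_coe
  simp only [h1, true_and, Set.mem_univ, and_true]
  rw [← coe_preimage_fdC, ← coe_preimage_fdoC, ← Set.preimage_sdiff, Set.mem_preimage, coe_smul_I_eq]

/-- **Almost-disjointness of the translates**: for `γ ≠ 1` in `GL₂(ℤ)`, `γF ∩ F` lies in the bad
set (if `g, γ⁻¹ g ∈ F` with `g • i` in the *interior* of `𝒟` then `γ = ±1` by Mathlib's
`ModularGroup.eq_one_or_neg_one_of_mem_fdo_mem_fd`, and `γ = −1` is excluded by the angles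
`θ(−g) = θ(g) + π`). [folklore] -/
theorem smul_gaussFD_inter_subset (γ : gl2zGL) (hγ : γ ≠ 1) :
    γ • gaussFD ∩ gaussFD ⊆ badSet := by
  rintro g ⟨⟨g', hg'F, rfl⟩, hgF⟩
  -- notation: `g = γ • g'`, both in `F`
  have hg'1 : g'.det = 1 := hg'F.1
  have hg1 : (γ • g').det = 1 := hgF.1
  rw [gl2zGL_smul_def, Matrix.det_mul, hg'1, mul_one] at hg1
  obtain ⟨δ, rfl⟩ := exists_ofSL2Z_eq γ hg1
  set G' : SL(2, ℝ) := ⟨g', hg'1⟩ with hG'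
  have hsmul : (ofSL2Z δ) • g' = (((δ : SL(2, ℝ)) * G' : SL(2, ℝ)) : Matrix (Fin 2) (Fin 2) ℝ) := by
    rw [gl2zGL_smul_def, coe_ofSL2Z, Matrix.SpecialLinearGroup.coe_mul]
  change (ofSL2Z δ) • g' ∈ gaussFD at hgF
  change (ofSL2Z δ) • g' ∈ badSet
  rw [hsmul] at hgF ⊢
  rw [show g' = ((G' : SL(2, ℝ)) : Matrix (Fin 2) (Fin 2) ℝ) from rfl] at hg'F
  rw [mem_gaussFD_iff_of_det_one] at hgF hg'F
  rw [mem_badSet_iff_of_det_one]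
  refine ⟨hgF.1, fun hint => ?_⟩
  -- `z := δ G' • i ∈ 𝒟ᵒ` and `δ⁻¹ • z = G' • i ∈ 𝒟` force `δ⁻¹ = ±1`
  have key : ∀ ε : SL(2, ℤ), (ε : SL(2, ℝ)) • (G' • UpperHalfPlane.I) = ε • (G' • UpperHalfPlane.I) :=
    fun ε => rfl
  rw [mul_smul, key] at hgF hint
  have h2 : δ⁻¹ • (δ • (G' • UpperHalfPlane.I)) ∈ 𝒟 := by
    rw [inv_smul_smul]; exact hg'F.1
  rcases ModularGroup.eq_one_or_neg_one_of_mem_fdo_mem_fd hint h2 with h | h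
  · rw [inv_eq_one] at h
    apply hγ
    rw [h]
    apply Subtype.ext
    change Matrix.GeneralLinearGroup.map (Int.castRingHom ℝ) (Matrix.SpecialLinearGroup.toGL 1) = 1
    simp
  · have hδ : δ = -1 := by
      have := congrArg (fun x : SL(2, ℤ) => x⁻¹) h
      simpa using this
    subst hδ
    -- angles: `θ((−1) G') = θ(G') + π`, both in `[0, π)`
    have e1 : (((-1 : SL(2, ℤ)) : SL(2, ℝ)) : Matrix (Fin 2) (Fin 2) ℝ) = -1 := by
      ext i j
      fin_cases i <;> fin_cases j <;> simp
    have e : ((((-1 : SL(2, ℤ)) : SL(2, ℝ)) * G' : SL(2, ℝ)) : Matrix (Fin 2) (Fin 2) ℝ) =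
        -((G' : SL(2, ℝ)) : Matrix (Fin 2) (Fin 2) ℝ) := by
      rw [Matrix.SpecialLinearGroup.coe_mul, e1, Matrix.neg_mul, Matrix.one_mul]
    have hθ := hgF.2
    rw [e, angleOf_neg] at hθ
    · exact not_mem_arc_zero_pi_and _ ⟨hg'F.2, hθ⟩
    · by_contra hc
      push Not at hc
      have hdet : ((G' : SL(2, ℝ)) : Matrix (Fin 2) (Fin 2) ℝ).det = 1 := G'.det_coe
      rw [Matrix.det_fin_two, hc.1, hc.2] at hdet
      simp at hdet

section Measure

variable [MeasurableSpace (Matrix (Fin 2) (Fin 2) ℝ)] [BorelSpace (Matrix (Fin 2) (Fin 2) ℝ)]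

/-- `F` is measurable. [folklore] -/
theorem measurableSet_gaussFD : MeasurableSet gaussFD :=
  measurableSet_coordSet measurableSet_fdC (measurableSet_arc (by linarith [Real.pi_pos]))

/-- The bad set is null: `μ(bad) = vol_ℍ(𝒟 ∖ 𝒟ᵒ) · 2π = 0`. [folklore] -/
theorem haarSL2pm_badSet : haarSL2pm badSet = 0 := by
  rw [badSet, haarSL2pm_coordSet (measurableSet_fdC.diff measurableSet_fdoC) MeasurableSet.univ,
    Set.preimage_sdiff, coe_preimage_fdC, coe_preimage_fdoC,
    Literature.NumberTheory.Automorphic.volume_modular_fd_diff_fdo, zero_mul]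

/-- **Gauss's fundamental domain is a fundamental domain** (in Mathlib's measure-theoretic sense)
for the left multiplication action of `GL₂(ℤ)` on `(M₂(ℝ), μ_{SL₂^±})`. [folklore] -/
theorem isFundamentalDomain_gaussFD : IsFundamentalDomain gl2zGL gaussFD haarSL2pm := by
  refine IsFundamentalDomain.mk'' measurableSet_gaussFD.nullMeasurableSet ?_ ?_ ?_
  · filter_upwards [measure_eq_zero_iff_ae_notMem.1 haarSL2pm_compl] with g hg
    simp only [Set.mem_compl_iff, Set.mem_setOf_eq, not_not] at hg
    exact exists_smul_mem_gaussFD hg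
  · intro γ hγ
    exact measure_mono_null (smul_gaussFD_inter_subset γ hγ) haarSL2pm_badSet
  · intro γ
    exact (measurePreserving_smul γ haarSL2pm).quasiMeasurePreserving

/-- **The volume of the fundamental domain**: `μ(F) = vol(𝒟) · π = (π/3) · π`. [folklore] -/
theorem haarSL2pm_gaussFD : haarSL2pm gaussFD = ENNReal.ofReal (π / 3) * ENNReal.ofReal π := by
  rw [gaussFD, haarSL2pm_coordSet measurableSet_fdC (measurableSet_arc (by linarith [Real.pi_pos])),
    coe_preimage_fdC, Literature.NumberTheory.Automorphic.volume_modular_fd,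
    volume_arc (by linarith [Real.pi_pos]), sub_zero]

/-- `μ(F) = π²/3` as a real number. [folklore] -/
theorem haarSL2pm_gaussFD_toReal : (haarSL2pm gaussFD).toReal = π ^ 2 / 3 := by
  rw [haarSL2pm_gaussFD, ENNReal.toReal_mul, ENNReal.toReal_ofReal (by positivity),
    ENNReal.toReal_ofReal Real.pi_pos.le]
  ring

end Measure

end Literature.MeasureTheory.Group


end
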